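import Literature.AlgebraicGeometry.Motives.SecOfForm
import Literature.AlgebraicGeometry.Motives.HypersurfaceFieldPoints
import Literature.AlgebraicGeometry.Motives.ProjectiveSpaceFieldPointsBijective
import Literature.AlgebraicGeometry.Motives.SegreEmbedding
import HarnessLib

/-!
# The Fano scheme of lines `F₁(X)` and the Grassmannian of lines `G(1, ℙⁿ)` as `k`-schemes

For a field `k` and a set `S ⊆ k[x₀, …, xₙ]` (the equations of a closed subscheme
`X = V₊(S) ⊆ ℙⁿ_k`, e.g. `S = {Q, C}` for a complete intersection of a quadric and a cubic) this
file constructs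

* `ProjectiveSpace.subschemeOfForms S : SchemeOver k` — **the closed subscheme `V₊(S) ⊆ ℙⁿ_k` cut
  out SCHEME-THEORETICALLY by `S`** (`Proj k[x]/(S)`; Hartshorne II Ex. 3.12 (b), Cor. 5.16 (a)),
  with its closed `k`-immersion `subschemeOfFormsι S` onto the zero locus `V₊(S)`
  (`range_subschemeOfFormsι`). Its ideal sheaf `zeroSchemeIdeal S` is the supremum, over `g ∈ S`
  and `d ≥ 0`, of the zero schemes (`GeneratingSections.Sec.zeroIdeal`, `Motives/SecZeroScheme`)
  of the sections `g_d(x₀, …, xₙ) ∈ Γ(ℙⁿ, 𝒪(d))` (`GeneratingSections.secOfForm`,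
  `Motives/SecOfForm`) of the homogeneous components `g_d` — i.e. the quasi-coherent ideal generated
  on `D₊(xᵢ)` by the `g_d/xᵢ^d`. (The tree's `completeIntersection` / `SmoothHypersurface.hypersurface`
  carry the *reduced induced* structure instead, which is not the right one for Fano schemes: `F₁`
  of a singular quadric surface is everywhere non-reduced, Eisenbud–Harris §6.1.1.) `L`-points:
  `subschemePointOfVec`, `exists_eq_subschemePointOfVec`, `subschemePointOfVec_eq_iff`
  (homogeneous coordinates, for `S` consisting of forms of positive degree).
* `FanoScheme.fanoEquations n k S` — the equations of `F₁(V₊(S))` in the Plücker space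
  `ℙ^{n²+2n}_k` with homogeneous coordinates `p_{ij}`, `0 ≤ i, j ≤ n` (ALL ordered pairs,
  enumerated by `FanoScheme.plIdx`; the classical `ℙ(Λ²kⁿ⁺¹)` is the linear subspace
  `p_{ii} = 0, p_{ij} = -p_{ji}`): the **alternation relations** (`alternationRel`), the **Plücker
  relations** `p_{ab}p_{cd} - p_{ac}p_{bd} + p_{ad}p_{bc}` (`plueckerRel`; Eisenbud–Harris §3.2.1,
  the relations `g_{a,b,c,d}` cutting out `G(2, n+1)`), and the **containment relations**
  (`containmentRel g α`): the coefficients in `ξ` of `g(p ⌟ ξ)`, `(p ⌟ ξ)_i = Σ_j p_{ij} ξ_j`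
  (`contraction`). For `p = u ∧ v` the vectors `p ⌟ ξ = ⟨v,ξ⟩u - ⟨u,ξ⟩v` sweep out the line
  `ℓ = ℙ(span(u, v))`, so these say `g|_ℓ ≡ 0`; on the standard chart `p_{ab} ≠ 0` of the
  Grassmannian (`u_a = v_b = 1`, `u_b = v_a = 0`, Eisenbud–Harris §3.2.2) the forms `⟨v,ξ⟩, -⟨u,ξ⟩`
  are part of a coordinate system, so the coefficients of `g(⟨v,ξ⟩u - ⟨u,ξ⟩v)` in `ξ` generate the
  same ideal as the coefficients `e_δ` of `g(su + tv)` in `s, t` — which are Eisenbud–Harris'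
  defining equations of the Fano scheme (§6.1.1: "the condition `L ⊂ X` is given by the vanishing
  of the coefficients of `α^*(g)`", and `F_k(Y) = ⋂_{Y ⊆ X hypersurface} F_k(X)` for arbitrary
  `Y`; Prop. 6.4: `F_k(X)` is the zero locus of the section `σ_g` of `Symᵈ 𝒮^*`; Prop. 6.6: `F_k(X)`
  represents flat families of `k`-planes on `X`, i.e. it is the Hilbert scheme of `k`-planes in `X`;
  Altman–Kleiman, *Foundations of the theory of Fano schemes*, Compositio Math. 34 (1977), 3–47).
  All these equations are forms (`isHomogeneous_containmentRel`: `coeff_α g(p ⌟ ξ)` has degree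
  `|α|` in `p`).
* `fanoSchemeOfLines n k S : SchemeOver k` — **the Fano scheme of lines `F₁(V₊(S))`**, the closed
  subscheme of `ℙ^{n²+2n}_k` cut out by `fanoEquations n k S`, with its **Plücker embedding**
  `fanoSchemeOfLinesι` (a closed immersion with image the zero locus of the Fano equations,
  `range_fanoSchemeOfLinesι`; hence `F₁` is projective, `isProjectiveOver_fanoSchemeOfLines`);
  `grassmannianOfLines n k = F₁(ℙⁿ)` — **the Grassmannian `G(1, ℙⁿ_k) = G(2, n+1)` as a
  `k`-scheme** with its Plücker embedding `plueckerEmbedding n k`; and the closed immersion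
  `fanoSchemeToGrassmannian : F₁(V₊(S)) ↪ G(1, ℙⁿ)` over the Plücker embeddings.

The sequel `Motives/FanoSchemeOfLinesPoints` identifies the `L`-points of `F₁(V₊(S))` (`L ⊇ k` a
field) with the lines `ℙ(W) ⊆ ℙⁿ_L` on which every `g ∈ S` vanishes identically
(`FanoScheme.algPointsEquivLinesOn`), via the decomposability of alternating vectors satisfying the
Plücker relations.

## What is NOT here

* The Grassmannians `G(r+1, n+1)` for `r ≥ 2` and the Fano schemes `F_r` of `r`-planes (same
  construction with `(r+1)`-fold indices and the general Plücker relations), the tautological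
  bundles, the universal line `{(ℓ, x) : x ∈ ℓ} → F₁`, orthogonal Grassmannians; smoothness /
  dimension statements (Debarre–Manivel, Math. Ann. 312 (1998), §2; Kollár, *Rational curves on
  algebraic varieties*, V.4) are theorems about the objects defined here.
* Mathlib's `Module.Grassmannian` is the functor of points (quotient convention, Stacks 089R)
  without a representing scheme; nothing here depends on it.

## References

* D. Eisenbud, J. Harris, *3264 and All That*, Cambridge (2016): §3.2.1 (Plücker relations for
  `G(2, n)`, eq. (3.1)), §3.2.2 (affine cover of the Grassmannian), §6.1.1 (definition of the Fano
  scheme), Prop. 6.4, Prop. 6.6. [EisenbudHarris2016]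
* R. Hartshorne, *Algebraic Geometry*, GTM 52 (1977): II Ex. 3.12 (b), II Cor. 5.16 (a),
  II Ex. 5.10, II Thm. 7.1. [Hartshorne1977]
* A. Altman, S. Kleiman, Foundations of the theory of Fano schemes, Compositio Math. 34 (1977).
* O. Debarre, L. Manivel, Math. Ann. 312 (1998), §2. [DebarreManivel1998]
* J. Kollár, *Rational Curves on Algebraic Varieties* (1996), I.1, V.4. [Kollar1996]
-/

noncomputable section

open CategoryTheory AlgebraicGeometry MvPolynomial TopologicalSpace

universe u

namespace Literature.AlgebraicGeometry.Motives

namespace ProjectiveSpace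

variable {k : Type u} [Field k] {n : ℕ}

attribute [local instance] MvPolynomial.gradedAlgebra

local notation "𝒜" => MvPolynomial.homogeneousSubmodule (Fin (n + 1)) k

/-! ### The ideal sheaf of `V₊(S)` -/

/-- The ideal sheaf of the hypersurface `V₊(g) ⊆ ℙⁿ_k` defined by a FORM `g` of degree `d`:
the zero scheme (`GeneratingSections.Sec.zeroIdeal`) of the section `g(x₀, …, xₙ) ∈ Γ(ℙⁿ, 𝒪(d))`
(`GeneratingSections.secOfForm` for the data `ofHom (𝟙 ℙⁿ)` of Hartshorne II Thm. 7.1 (a)),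
i.e. the quasi-coherent ideal generated on `D₊(xᵢ)` by `g/xᵢ^d` (Hartshorne II Ex. 3.12 (b) and
II Cor. 5.16 (a): closed subschemes of `Proj S` determined by homogeneous ideals; the zero scheme
of a section, Görtz–Wedhorn I (13.13)). [folklore] -/
def formIdealSheaf (g : MvPolynomial (Fin (n + 1)) k) (d : ℕ) (hg : g.IsHomogeneous d) :
    (Proj 𝒜).IdealSheafData :=
  ((GeneratingSections.ofHom (𝟙 (Proj 𝒜))).secOfForm (Segre.toSpec (Fin (n + 1)) k) g hg).zeroIdeal

/-- The support of the ideal sheaf of `V₊(g)` (`deg g > 0`) is the zero locus `V₊(g)`: a point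
`y` lies on it iff `g ∈ 𝔭_y`. [folklore] -/
theorem mem_support_formIdealSheaf_iff (g : MvPolynomial (Fin (n + 1)) k) {d : ℕ} (hd : 0 < d)
    (hg : g.IsHomogeneous d) (y : Proj 𝒜) :
    y ∈ (formIdealSheaf g d hg).support ↔ g ∈ y.asHomogeneousIdeal :=
  GeneratingSections.mem_support_zeroIdeal_secOfForm_ofHom_iff
    (Segre.toSpec (Fin (n + 1)) k) (𝟙 (Proj 𝒜)) (Category.id_comp _) hd g hg y

/-- The degree-`d` contribution of an arbitrary polynomial `g` to the ideal sheaf of `V₊(g)`: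
for `d ≥ 1` the ideal sheaf of `V₊(g_d)`, `g_d` the homogeneous component of degree `d`; for
`d = 0` the unit ideal sheaf (empty subscheme) if the constant term `g₀` is non-zero and the zero
ideal sheaf otherwise (a homogeneous ideal contains `g` iff it contains every `g_d`).
[folklore] -/
def componentIdealSheaf (g : MvPolynomial (Fin (n + 1)) k) : ℕ → (Proj 𝒜).IdealSheafData
  | 0 => ⨆ (_ : constantCoeff g ≠ 0), ⊤
  | (d + 1) => formIdealSheaf (homogeneousComponent (d + 1) g) (d + 1)
      (homogeneousComponent_isHomogeneous (d + 1) g)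

/-- `y` lies on the support of the degree-`d` contribution of `g` iff `g_d ∈ 𝔭_y`. [folklore] -/
theorem mem_support_componentIdealSheaf_iff (g : MvPolynomial (Fin (n + 1)) k) (d : ℕ)
    (y : Proj 𝒜) :
    y ∈ (componentIdealSheaf g d).support ↔ homogeneousComponent d g ∈ y.asHomogeneousIdeal := by
  cases d with
  | zero =>
    rw [componentIdealSheaf, Scheme.IdealSheafData.support_iSup, Closeds.mem_iInf,
      homogeneousComponent_zero, ← constantCoeff_eq]
    by_cases hc : constantCoeff g = 0
    · constructor
      · intro _
        rw [hc, map_zero]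
        exact Submodule.zero_mem _
      · intro _ h
        exact absurd hc h
    · constructor
      · intro h
        have h' := h hc
        rw [Scheme.IdealSheafData.support_top] at h'
        have h'' : y ∈ ((⊥ : Closeds (Proj 𝒜)) : Set (Proj 𝒜)) := h'
        rw [Closeds.coe_bot] at h''
        exact absurd h'' (Set.notMem_empty y)
      · intro h
        exfalso
        have hunit : IsUnit (C (constantCoeff g) : MvPolynomial (Fin (n + 1)) k) :=
          (isUnit_iff_ne_zero.mpr hc).map C
        exact y.isPrime.ne_top (Ideal.eq_top_of_isUnit_mem _ h hunit)
  | succ d =>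
    exact mem_support_formIdealSheaf_iff _ d.succ_pos _ y

/-- **The ideal sheaf of `V₊(S) ⊆ ℙⁿ_k`** for a set `S ⊆ k[x₀, …, xₙ]`: the quasi-coherent ideal
sheaf generated by (the homogeneous components of) the elements of `S`, i.e. the supremum of the
ideal sheaves of the hypersurfaces `V₊(g_d)`, `g ∈ S`, `d ≥ 0`. Its closed subscheme is
`Proj (k[x]/I)` for the homogeneous ideal `I` generated by `S` (Hartshorne II Ex. 3.12 (b),
II Cor. 5.16 (a); two ideals with the same saturation give the same subscheme, II Ex. 5.10).
[folklore] -/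
def zeroSchemeIdeal (S : Set (MvPolynomial (Fin (n + 1)) k)) : (Proj 𝒜).IdealSheafData :=
  ⨆ g ∈ S, ⨆ d : ℕ, componentIdealSheaf g d

/-- `y ∈ Supp 𝒪/𝓘_{V₊(S)}` iff `S ⊆ 𝔭_y`. [folklore] -/
theorem mem_support_zeroSchemeIdeal_iff (S : Set (MvPolynomial (Fin (n + 1)) k)) (y : Proj 𝒜) :
    y ∈ (zeroSchemeIdeal S).support ↔ S ⊆ y.asHomogeneousIdeal := by
  simp only [zeroSchemeIdeal, Scheme.IdealSheafData.support_iSup, Closeds.mem_iInf,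
    mem_support_componentIdealSheaf_iff]
  constructor
  · intro h g hg
    rw [SetLike.mem_coe]
    exact (mem_iff_homogeneousComponent_mem y.asHomogeneousIdeal.isHomogeneous g).mpr (h g hg)
  · intro h g hg d
    exact homogeneousComponent_mem_of_mem y.asHomogeneousIdeal.isHomogeneous (h hg) d

/-- **`Supp 𝒪/𝓘_{V₊(S)} = V₊(S)`**, the zero locus of `S` in `Proj k[x₀, …, xₙ]`. [folklore] -/
theorem coe_support_zeroSchemeIdeal (S : Set (MvPolynomial (Fin (n + 1)) k)) :
    ((zeroSchemeIdeal S).support : Set (Proj 𝒜)) = ProjectiveSpectrum.zeroLocus 𝒜 S :=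
  Set.ext fun y => mem_support_zeroSchemeIdeal_iff S y

/-- The ideal sheaf of `V₊(S)` is monotone in `S`. [folklore] -/
theorem zeroSchemeIdeal_mono {S T : Set (MvPolynomial (Fin (n + 1)) k)} (h : S ⊆ T) :
    zeroSchemeIdeal S ≤ zeroSchemeIdeal T :=
  iSup₂_le fun g hg => le_iSup₂ (f := fun g (_ : g ∈ T) => ⨆ d : ℕ, componentIdealSheaf g d) g (h hg)

/-! ### The closed subscheme `V₊(S)` as a `k`-scheme -/

/-- **The closed subscheme `V₊(S) ⊆ ℙⁿ_k` cut out scheme-theoretically by `S ⊆ k[x₀, …, xₙ]`**,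
`Proj k[x]/(S)`, as a `k`-scheme `V₊(S) ↪ ℙⁿ_k → Spec k` (Mathlib `IdealSheafData.subscheme` of
`zeroSchemeIdeal S`; Hartshorne II Ex. 3.12 (b): the closed subscheme of `Proj S` determined by a
homogeneous ideal, and II Cor. 5.16 (a): every closed subscheme of `ℙ^r_A` is of this form).
[cite: Hartshorne1977, II Ex. 3.12 (b) and II Cor. 5.16 (a)] -/
def subschemeOfForms (S : Set (MvPolynomial (Fin (n + 1)) k)) : SchemeOver k :=
  Over.mk ((zeroSchemeIdeal S).subschemeι ≫ (projectiveSpace n k).hom)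

/-- The closed immersion `V₊(S) ↪ ℙⁿ_k` over `k`. [folklore] -/
def subschemeOfFormsι (S : Set (MvPolynomial (Fin (n + 1)) k)) :
    subschemeOfForms S ⟶ projectiveSpace n k :=
  Over.homMk (zeroSchemeIdeal S).subschemeι rfl

/-- `subschemeOfFormsι` is Mathlib's `subschemeι` on underlying schemes (`rfl`). [folklore] -/
@[simp]
theorem subschemeOfFormsι_left (S : Set (MvPolynomial (Fin (n + 1)) k)) :
    (subschemeOfFormsι S).left = (zeroSchemeIdeal S).subschemeι := rfl

/-- The structure morphism of `V₊(S)` is `V₊(S) ↪ ℙⁿ_k → Spec k` (`rfl`). [folklore] -/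
theorem subschemeOfForms_hom (S : Set (MvPolynomial (Fin (n + 1)) k)) :
    (subschemeOfForms S).hom = (zeroSchemeIdeal S).subschemeι ≫ (projectiveSpace n k).hom := rfl

/-- `V₊(S) ↪ ℙⁿ_k` is a closed immersion. [folklore] -/
instance isClosedImmersion_subschemeOfFormsι_left (S : Set (MvPolynomial (Fin (n + 1)) k)) :
    IsClosedImmersion (subschemeOfFormsι S).left :=
  inferInstanceAs (IsClosedImmersion (zeroSchemeIdeal S).subschemeι)

/-- **The image of `V₊(S) ↪ ℙⁿ_k` is the zero locus `V₊(S)`.** [folklore] -/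
theorem range_subschemeOfFormsι (S : Set (MvPolynomial (Fin (n + 1)) k)) :
    Set.range (subschemeOfFormsι S).left = ProjectiveSpectrum.zeroLocus 𝒜 S := by
  refine (Scheme.IdealSheafData.range_subschemeι (zeroSchemeIdeal S)).trans ?_
  exact coe_support_zeroSchemeIdeal S

/-- `V₊(S)` is projective over `k`. [folklore] -/
theorem isProjectiveOver_subschemeOfForms (S : Set (MvPolynomial (Fin (n + 1)) k)) :
    IsProjectiveOver (subschemeOfForms S) :=
  ⟨n, subschemeOfFormsι S, inferInstance⟩

/-- `V₊(T) ↪ V₊(S)` for `S ⊆ T`: the closed immersion of `k`-schemes induced by the inclusion of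
ideal sheaves (Mathlib `IdealSheafData.inclusion`). [folklore] -/
def subschemeOfFormsInclusion {S T : Set (MvPolynomial (Fin (n + 1)) k)} (h : S ⊆ T) :
    subschemeOfForms T ⟶ subschemeOfForms S :=
  Over.homMk (Scheme.IdealSheafData.inclusion (zeroSchemeIdeal_mono h)) (by
    change Scheme.IdealSheafData.inclusion _ ≫ (zeroSchemeIdeal S).subschemeι ≫ _ =
      (zeroSchemeIdeal T).subschemeι ≫ _
    rw [Scheme.IdealSheafData.inclusion_subschemeι_assoc])

/-- The inclusion `V₊(T) ↪ V₊(S)` commutes with the embeddings into `ℙⁿ_k`. [folklore] -/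
@[simp]
theorem subschemeOfFormsInclusion_ι {S T : Set (MvPolynomial (Fin (n + 1)) k)} (h : S ⊆ T) :
    subschemeOfFormsInclusion h ≫ subschemeOfFormsι S = subschemeOfFormsι T := by
  ext : 1
  exact Scheme.IdealSheafData.inclusion_subschemeι (zeroSchemeIdeal_mono h)

/-- `V₊(T) ↪ V₊(S)` is a closed immersion. [folklore] -/
instance isClosedImmersion_subschemeOfFormsInclusion_left {S T : Set (MvPolynomial (Fin (n + 1)) k)}
    (h : S ⊆ T) : IsClosedImmersion (subschemeOfFormsInclusion h).left :=
  inferInstanceAs (IsClosedImmersion (Scheme.IdealSheafData.inclusion (zeroSchemeIdeal_mono h)))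

/-! ### Field-valued points of `V₊(S)` -/

section Points

variable {L : Type u} [Field L] [Algebra k L]

/-- For a set `S` of forms of positive degree: the point with homogeneous coordinates `z ≠ 0`
lies in `V₊(S)` iff every `g ∈ S` vanishes at `z`. [folklore] -/
theorem pt_pointOfVec_mem_zeroLocus_set_iff {S : Set (MvPolynomial (Fin (n + 1)) k)}
    (hS : ∀ g ∈ S, ∃ m, 0 < m ∧ g.IsHomogeneous m) (z : Fin (n + 1) → L) (hz : z ≠ 0) :
    (pointOfVec k z hz).pt ∈ ProjectiveSpectrum.zeroLocus 𝒜 S ↔ ∀ g ∈ S, aeval z g = 0 := by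
  constructor
  · intro h g hg
    obtain ⟨m, hm, hgm⟩ := hS g hg
    have h1 : (pointOfVec k z hz).pt ∈ ProjectiveSpectrum.zeroLocus 𝒜 {g} :=
      ProjectiveSpectrum.zeroLocus_anti_mono 𝒜 (Set.singleton_subset_iff.mpr hg) h
    exact (pt_pointOfVec_mem_zeroLocus_iff z hz hm (by simpa using hgm)).mp h1
  · intro h g hg
    obtain ⟨m, hm, hgm⟩ := hS g hg
    have h1 := (pt_pointOfVec_mem_zeroLocus_iff (k := k) z hz hm (by simpa using hgm)).mpr (h g hg)
    exact Set.singleton_subset_iff.mp h1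

/-- **The `L`-point of `V₊(S)` with homogeneous coordinates `z`**, for `z ≠ 0` a common zero of the
forms in `S` (lift of `ProjectiveSpace.pointOfVec` through the closed immersion `V₊(S) ↪ ℙⁿ_k`;
`Spec L` is reduced). [folklore] -/
def subschemePointOfVec {S : Set (MvPolynomial (Fin (n + 1)) k)}
    (hS : ∀ g ∈ S, ∃ m, 0 < m ∧ g.IsHomogeneous m) (z : Fin (n + 1) → L) (hz : z ≠ 0)
    (hzS : ∀ g ∈ S, aeval z g = 0) : AlgPoints (subschemeOfForms S) L :=
  (pointOfVec k z hz).liftClosed (subschemeOfFormsι S) (by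
    rw [range_subschemeOfFormsι]
    exact (pt_pointOfVec_mem_zeroLocus_set_iff hS z hz).mpr hzS)

/-- The point of `V₊(S)` with coordinates `z` maps to the point of `ℙⁿ_k` with coordinates `z`.
[folklore] -/
@[simp]
theorem map_subschemePointOfVec {S : Set (MvPolynomial (Fin (n + 1)) k)}
    (hS : ∀ g ∈ S, ∃ m, 0 < m ∧ g.IsHomogeneous m) (z : Fin (n + 1) → L) (hz : z ≠ 0)
    (hzS : ∀ g ∈ S, aeval z g = 0) :
    AlgPoints.map (subschemeOfFormsι S) (subschemePointOfVec hS z hz hzS) = pointOfVec k z hz :=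
  AlgPoints.map_liftClosed _ _ _

/-- **Every `L`-point of `V₊(S)` has homogeneous coordinates**, a common zero `z ≠ 0` of `S`.
[folklore] -/
theorem exists_eq_subschemePointOfVec {S : Set (MvPolynomial (Fin (n + 1)) k)}
    (hS : ∀ g ∈ S, ∃ m, 0 < m ∧ g.IsHomogeneous m) (Q : AlgPoints (subschemeOfForms S) L) :
    ∃ (z : Fin (n + 1) → L) (hz : z ≠ 0) (hzS : ∀ g ∈ S, aeval z g = 0),
      Q = subschemePointOfVec hS z hz hzS := by
  obtain ⟨z, hz, hP⟩ := exists_eq_pointOfVec (AlgPoints.map (subschemeOfFormsι S) Q)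
  have hmem : (pointOfVec k z hz).pt ∈ ProjectiveSpectrum.zeroLocus 𝒜 S := by
    rw [← hP, ← range_subschemeOfFormsι S]
    exact AlgPoints.pt_map_mem_range _ Q
  refine ⟨z, hz, (pt_pointOfVec_mem_zeroLocus_set_iff hS z hz).mp hmem, ?_⟩
  apply AlgPoints.map_injective_of_mono (subschemeOfFormsι S)
  rw [map_subschemePointOfVec, hP]

/-- **Homogeneous coordinates on `V₊(S)` are unique up to `Lˣ`.** [folklore] -/
theorem subschemePointOfVec_eq_iff {S : Set (MvPolynomial (Fin (n + 1)) k)}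
    (hS : ∀ g ∈ S, ∃ m, 0 < m ∧ g.IsHomogeneous m) (z z' : Fin (n + 1) → L) (hz : z ≠ 0)
    (hz' : z' ≠ 0) (hzS : ∀ g ∈ S, aeval z g = 0) (hz'S : ∀ g ∈ S, aeval z' g = 0) :
    subschemePointOfVec hS z hz hzS = subschemePointOfVec hS z' hz' hz'S ↔
      ∃ c : L, c ≠ 0 ∧ z' = c • z := by
  rw [← pointOfVec_eq_pointOfVec_iff (k := k) z z' hz hz',
    ← map_subschemePointOfVec hS z hz hzS, ← map_subschemePointOfVec hS z' hz' hz'S]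
  exact ⟨fun h => by rw [h], fun h => AlgPoints.map_injective_of_mono _ h⟩

end Points

end ProjectiveSpace

/-! ## Plücker coordinates of lines and the Fano equations -/

namespace FanoScheme

section Equations

variable (n : ℕ) (k : Type u) [CommRing k]

/-- `n² + 2n`, so that `ℙ^{n²+2n}` has the `(n+1)²` homogeneous coordinates `p_{ij}`,
`i, j ∈ {0, …, n}`. -/
local notation "𝐍" => n * n + 2 * n

/-- The enumeration `(i, j) ↦ (n+1)·i + j` of the pairs of indices by the homogeneous coordinates of
`ℙ^{n²+2n}` (lexicographic, as for the Segre embedding, Hartshorne I Ex. 2.14). [folklore] -/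
def plIdx : Fin (n + 1) × Fin (n + 1) ≃ Fin (𝐍 + 1) :=
  finProdFinEquiv.trans (finCongr (by ring))

/-- **The Plücker coordinate `p_{ij}`** as a variable of the homogeneous coordinate ring
`k[p_{ij} : 0 ≤ i, j ≤ n]` of `ℙ^{n²+2n}`. We use ALL ordered pairs `(i, j)` and impose the
alternation relations `p_{ii} = 0`, `p_{ij} + p_{ji} = 0` as equations (`alternationRel`), so that
the classical Plücker space `ℙ(Λ² kⁿ⁺¹) = ℙ^{n(n+1)/2 - 1}` (coordinates `p_{ij}`, `i < j`,
Eisenbud–Harris §3.2.1) sits in `ℙ^{n²+2n}` as a linear subspace. [folklore] -/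
abbrev pl (i j : Fin (n + 1)) : MvPolynomial (Fin (𝐍 + 1)) k :=
  X (plIdx n (i, j))

/-- The **alternation relations**: `p_{ii}` for `i = j` and `p_{ij} + p_{ji}` for `i ≠ j` (both
families are needed in characteristic `2`). [folklore] -/
def alternationRel (ij : Fin (n + 1) × Fin (n + 1)) : MvPolynomial (Fin (𝐍 + 1)) k :=
  if ij.1 = ij.2 then pl n k ij.1 ij.1 else pl n k ij.1 ij.2 + pl n k ij.2 ij.1

/-- The **Plücker relations** `p_{ab} p_{cd} - p_{ac} p_{bd} + p_{ad} p_{bc}` (`a, b, c, d ≤ n`),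
the quadrics cutting out the Grassmannian of lines `G(2, n+1) = G(1, ℙⁿ)` in its Plücker embedding
(Eisenbud–Harris, *3264 and all that*, §3.2.1: the quadrics `g_{a,b,c,d}` "minimally generate the
ideal of the Grassmannian" `G(2, n)`, eq. (3.1) for `G(2, 4)`). For an alternating `p` they say
that `p ∧ p = 0`, i.e. that `p` is decomposable, `p = u ∧ v`. [cite: EisenbudHarris2016, §3.2.1] -/
def plueckerRel (q : Fin (n + 1) × Fin (n + 1) × Fin (n + 1) × Fin (n + 1)) :
    MvPolynomial (Fin (𝐍 + 1)) k :=
  pl n k q.1 q.2.1 * pl n k q.2.2.1 q.2.2.2 - pl n k q.1 q.2.2.1 * pl n k q.2.1 q.2.2.2 +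
    pl n k q.1 q.2.2.2 * pl n k q.2.1 q.2.2.1

/-- The **contraction** `(p ⌟ ξ)_i = Σ_j p_{ij} ξ_j`: the vector of linear forms in auxiliary
variables `ξ₀, …, ξₙ` with coefficients in `k[p]`. For `p = u ∧ v` (`p_{ij} = uᵢvⱼ - uⱼvᵢ`) one has
`p ⌟ ξ = ⟨v, ξ⟩ u - ⟨u, ξ⟩ v`, and as `ξ` varies these are exactly the points of the line
`ℓ_p = ℙ(span(u, v))` (the line is recovered from its Plücker coordinates as the row space of the
alternating matrix `(p_{ij})`, cf. `FanoScheme.span_pair_le_of_rows_mem` in the sequel). [folklore] -/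
def contraction (i : Fin (n + 1)) : MvPolynomial (Fin (n + 1)) (MvPolynomial (Fin (𝐍 + 1)) k) :=
  ∑ j : Fin (n + 1), C (pl n k i j) * X j

/-- The **containment relations** of a polynomial `g ∈ k[x₀, …, xₙ]`: the coefficients (in `ξ`) of
`g(p ⌟ ξ) ∈ k[p][ξ]`. On the Grassmannian they cut out the lines `ℓ ⊆ ℙⁿ` with `g|_ℓ = 0`, i.e.
`ℓ ⊆ V₊(g)` scheme-theoretically: on the chart `p_{ab} ≠ 0`, normalising `p = u ∧ v` with
`u_a = v_b = 1`, `u_b = v_a = 0`, the forms `⟨v, ξ⟩, -⟨u, ξ⟩` are independent, so the coefficients of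
`g(⟨v,ξ⟩u - ⟨u,ξ⟩v)` in `ξ` generate the same ideal as the coefficients of `g(su + tv)` in `s, t`,
which are the local equations of the Fano scheme as the zero scheme of the section of `Symᵈ 𝒮^∨`
induced by `g` (Eisenbud–Harris, *3264 and all that*, §6.1.1 and Prop. 6.4; Altman–Kleiman,
*Foundations of the theory of Fano schemes*, Compositio Math. 34 (1977)).
[cite: EisenbudHarris2016, §6.1.1 and Prop. 6.4] -/
def containmentRel (g : MvPolynomial (Fin (n + 1)) k) (α : Fin (n + 1) →₀ ℕ) :
    MvPolynomial (Fin (𝐍 + 1)) k :=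
  coeff α (aeval (contraction n k) g)

/-- **The equations of the Grassmannian of lines** `G(1, ℙⁿ) ⊆ ℙ^{n²+2n}`: alternation and Plücker
relations. [folklore] -/
def grassmannEquations : Set (MvPolynomial (Fin (𝐍 + 1)) k) :=
  Set.range (alternationRel n k) ∪ Set.range (plueckerRel n k)

/-- **The equations of the Fano scheme of lines** `F₁(V₊(S)) ⊆ ℙ^{n²+2n}` of the closed subscheme
`V₊(S) ⊆ ℙⁿ` cut out by `S ⊆ k[x₀, …, xₙ]`: the Grassmann equations and the containment relations
of all `g ∈ S`. [folklore] -/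
def fanoEquations (S : Set (MvPolynomial (Fin (n + 1)) k)) : Set (MvPolynomial (Fin (𝐍 + 1)) k) :=
  grassmannEquations n k ∪ ⋃ g ∈ S, Set.range (containmentRel n k g)

/-- The Grassmann equations are among the Fano equations. [folklore] -/
theorem grassmannEquations_subset_fanoEquations (S : Set (MvPolynomial (Fin (n + 1)) k)) :
    grassmannEquations n k ⊆ fanoEquations n k S :=
  Set.subset_union_left

/-- The Fano equations are monotone in `S`. [folklore] -/
theorem fanoEquations_mono {S T : Set (MvPolynomial (Fin (n + 1)) k)} (h : S ⊆ T) :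
    fanoEquations n k S ⊆ fanoEquations n k T :=
  Set.union_subset_union_right _ (Set.biUnion_subset_biUnion_left h)

/-- Without equations for `X` the Fano equations are the Grassmann equations: `F₁(ℙⁿ) = G(1, ℙⁿ)`.
[folklore] -/
@[simp]
theorem fanoEquations_empty : fanoEquations n k (∅ : Set (MvPolynomial (Fin (n + 1)) k)) =
    grassmannEquations n k := by
  simp [fanoEquations]

/-- The containment relations of `g ∈ S` are among the Fano equations. [folklore] -/
theorem containmentRel_mem_fanoEquations {S : Set (MvPolynomial (Fin (n + 1)) k)}
    {g : MvPolynomial (Fin (n + 1)) k} (hg : g ∈ S) (α : Fin (n + 1) →₀ ℕ) :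
    containmentRel n k g α ∈ fanoEquations n k S :=
  Or.inr (Set.mem_biUnion hg ⟨α, rfl⟩)

/-! ### Homogeneity of the equations -/

/-- `p_{ij}` is a linear form. [folklore] -/
theorem isHomogeneous_pl (i j : Fin (n + 1)) : (pl n k i j).IsHomogeneous 1 :=
  isHomogeneous_X k _

/-- The alternation relations are linear forms. [folklore] -/
theorem isHomogeneous_alternationRel (ij : Fin (n + 1) × Fin (n + 1)) :
    (alternationRel n k ij).IsHomogeneous 1 := by
  unfold alternationRel
  split_ifs
  · exact isHomogeneous_pl n k _ _
  · exact (isHomogeneous_pl n k _ _).add (isHomogeneous_pl n k _ _)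

/-- The Plücker relations are quadrics. [folklore] -/
theorem isHomogeneous_plueckerRel (q : Fin (n + 1) × Fin (n + 1) × Fin (n + 1) × Fin (n + 1)) :
    (plueckerRel n k q).IsHomogeneous 2 :=
  (((isHomogeneous_pl n k _ _).mul (isHomogeneous_pl n k _ _)).sub
    ((isHomogeneous_pl n k _ _).mul (isHomogeneous_pl n k _ _))).add
    ((isHomogeneous_pl n k _ _).mul (isHomogeneous_pl n k _ _))

/-- A polynomial `P ∈ k[p][ξ]` is *bihomogeneous of bidegree `(e, e)` termwise* if its `ξ^α`
coefficient is a form of degree `|α|` in `p`; e.g. `g(p ⌟ ξ)` for every `g`. [folklore] -/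
def IsBalanced (P : MvPolynomial (Fin (n + 1)) (MvPolynomial (Fin (𝐍 + 1)) k)) : Prop :=
  ∀ α : Fin (n + 1) →₀ ℕ, (coeff α P).IsHomogeneous α.degree

variable {n k}

/-- Balanced polynomials are closed under addition. [folklore] -/
theorem IsBalanced.add {P Q : MvPolynomial (Fin (n + 1)) (MvPolynomial (Fin (𝐍 + 1)) k)}
    (hP : IsBalanced n k P) (hQ : IsBalanced n k Q) : IsBalanced n k (P + Q) := fun α => by
  rw [coeff_add]
  exact (hP α).add (hQ α)

/-- Balanced polynomials are closed under multiplication. [folklore] -/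
theorem IsBalanced.mul {P Q : MvPolynomial (Fin (n + 1)) (MvPolynomial (Fin (𝐍 + 1)) k)}
    (hP : IsBalanced n k P) (hQ : IsBalanced n k Q) : IsBalanced n k (P * Q) := fun α => by
  rw [coeff_mul]
  refine IsHomogeneous.sum _ _ _ fun βγ hβγ => ?_
  have h := Finset.mem_antidiagonal.mp hβγ
  have hdeg : α.degree = βγ.1.degree + βγ.2.degree := by
    rw [← h, map_add]
  rw [hdeg]
  exact (hP βγ.1).mul (hQ βγ.2)

/-- Constants of `k` are balanced. [folklore] -/
theorem isBalanced_C_C (c : k) : IsBalanced n k (C (C c)) := fun α => by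
  classical
  rw [coeff_C]
  split_ifs with h
  · subst h
    rw [map_zero]
    exact isHomogeneous_C _ c
  · exact isHomogeneous_zero _ _ _

/-- The contraction `(p ⌟ ξ)_i` is balanced. [folklore] -/
theorem isBalanced_contraction (i : Fin (n + 1)) : IsBalanced n k (contraction n k i) := fun α => by
  classical
  unfold contraction
  rw [coeff_sum]
  refine IsHomogeneous.sum _ _ _ fun j _ => ?_
  rw [coeff_C_mul, coeff_X]
  split_ifs with h
  · subst h
    rw [mul_one, Finsupp.degree_single]
    exact isHomogeneous_pl n k i j
  · rw [mul_zero]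
    exact isHomogeneous_zero _ _ _

variable (n k)

/-- `g(p ⌟ ξ)` is balanced for every `g ∈ k[x₀, …, xₙ]`. [folklore] -/
theorem isBalanced_aeval_contraction (g : MvPolynomial (Fin (n + 1)) k) :
    IsBalanced n k (aeval (contraction n k) g) := by
  induction g using MvPolynomial.induction_on with
  | C c =>
    rw [aeval_C]
    exact isBalanced_C_C c
  | add p q hp hq =>
    rw [map_add]
    exact hp.add hq
  | mul_X p i hp =>
    rw [map_mul, aeval_X]
    exact hp.mul (isBalanced_contraction i)

/-- **The containment relation `coeff_α g(p ⌟ ξ)` is a form of degree `|α|` in the Plücker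
coordinates.** [folklore] -/
theorem isHomogeneous_containmentRel (g : MvPolynomial (Fin (n + 1)) k) (α : Fin (n + 1) →₀ ℕ) :
    (containmentRel n k g α).IsHomogeneous α.degree :=
  isBalanced_aeval_contraction n k g α

/-- The constant containment relation is the constant term of `g`. [folklore] -/
theorem containmentRel_zero (g : MvPolynomial (Fin (n + 1)) k) :
    containmentRel n k g 0 = C (constantCoeff g) := by
  have key : (constantCoeff.comp (aeval (contraction n k)).toRingHom :
      MvPolynomial (Fin (n + 1)) k →+* MvPolynomial (Fin (𝐍 + 1)) k) = C.comp constantCoeff := by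
    refine ringHom_ext (fun c => ?_) (fun i => ?_)
    · simp only [RingHom.comp_apply, AlgHom.toRingHom_eq_coe, RingHom.coe_coe, aeval_C,
        constantCoeff_C, MvPolynomial.algebraMap_eq, MvPolynomial.algebraMap_apply]
    · simp only [RingHom.comp_apply, AlgHom.toRingHom_eq_coe, RingHom.coe_coe, aeval_X,
        constantCoeff_X, map_zero, contraction, map_sum, constantCoeff_C, constantCoeff_X,
        map_mul, mul_zero, Finset.sum_const_zero]
  have h := RingHom.congr_fun key g
  simpa [containmentRel, ← constantCoeff_eq] using h

end Equations

end FanoScheme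

/-! ## The Fano scheme of lines and the Grassmannian of lines as `k`-schemes -/

section Scheme

open FanoScheme

variable (n : ℕ) (k : Type u) [Field k]

local notation "𝐍" => n * n + 2 * n
local notation "𝒫" => MvPolynomial.homogeneousSubmodule (Fin (𝐍 + 1)) k

attribute [local instance] MvPolynomial.gradedAlgebra

/-- **The Fano scheme of lines `F₁(X)` of the closed subscheme `X = V₊(S) ⊆ ℙⁿ_k`** cut out by
`S ⊆ k[x₀, …, xₙ]`, as a `k`-scheme: the closed subscheme of the Plücker space `ℙ^{n²+2n}_k` cut
out scheme-theoretically by the Fano equations (`fanoEquations`: alternation and Plücker relations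
of `G(1, ℙⁿ)`, and the containment relations `g(p ⌟ ξ) ≡ 0`, `g ∈ S`). This is the Hilbert scheme
of lines in `X`, equivalently (for `X` a hypersurface or complete intersection) the zero scheme in
`G(1, ℙⁿ)` of the section of `⊕ Sym^{dᵢ} 𝒮^∨` induced by the equations (Altman–Kleiman,
*Foundations of the theory of Fano schemes*, Compositio Math. 34 (1977), §1 and Thm. (1.3)
(representability); Eisenbud–Harris, *3264 and all that*, §6.1; Debarre–Manivel, Math. Ann. 312
(1998), §2; Kollár, *Rational curves on algebraic varieties*, I.1 and V.4). Its `L`-points are the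
lines `ℙ(W) ⊆ ℙⁿ_L`, `dim W = 2`, with `g|_W = 0` for all `g ∈ S` (`FanoScheme.algPointsEquivLinesOn` in
`Motives/FanoSchemeOfLinesPoints`). [cite: EisenbudHarris2016, §6.1.1 and Prop. 6.6] -/
abbrev fanoSchemeOfLines (S : Set (MvPolynomial (Fin (n + 1)) k)) : SchemeOver k :=
  ProjectiveSpace.subschemeOfForms (fanoEquations n k S)

/-- **The Plücker embedding of the Fano scheme**, the closed immersion
`F₁(V₊(S)) ↪ ℙ^{n²+2n}_k` over `k`. [folklore] -/
abbrev fanoSchemeOfLinesι (S : Set (MvPolynomial (Fin (n + 1)) k)) :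
    fanoSchemeOfLines n k S ⟶ projectiveSpace 𝐍 k :=
  ProjectiveSpace.subschemeOfFormsι (fanoEquations n k S)

/-- On underlying schemes the Plücker embedding is Mathlib's `subschemeι` of the Fano ideal sheaf
(`rfl`). [folklore] -/
@[simp]
theorem fanoSchemeOfLinesι_left (S : Set (MvPolynomial (Fin (n + 1)) k)) :
    (fanoSchemeOfLinesι n k S).left =
      (ProjectiveSpace.zeroSchemeIdeal (fanoEquations n k S)).subschemeι := rfl

/-- The Plücker embedding of the Fano scheme is a closed immersion. [folklore] -/
instance isClosedImmersion_fanoSchemeOfLinesι_left (S : Set (MvPolynomial (Fin (n + 1)) k)) :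
    IsClosedImmersion (fanoSchemeOfLinesι n k S).left :=
  ProjectiveSpace.isClosedImmersion_subschemeOfFormsι_left _

/-- **The image of the Plücker embedding of `F₁(V₊(S))` is the zero locus of the Fano equations.**
[folklore] -/
theorem range_fanoSchemeOfLinesι (S : Set (MvPolynomial (Fin (n + 1)) k)) :
    Set.range (fanoSchemeOfLinesι n k S).left =
      ProjectiveSpectrum.zeroLocus 𝒫 (fanoEquations n k S) :=
  ProjectiveSpace.range_subschemeOfFormsι _

/-- The Fano scheme of lines is projective over `k`. [folklore] -/
theorem isProjectiveOver_fanoSchemeOfLines (S : Set (MvPolynomial (Fin (n + 1)) k)) :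
    IsProjectiveOver (fanoSchemeOfLines n k S) :=
  ⟨𝐍, fanoSchemeOfLinesι n k S, inferInstance⟩

/-- **The Grassmannian of lines `G(1, ℙⁿ_k) = G(2, n+1)`** as a `k`-scheme: the Fano scheme of lines
of `ℙⁿ` itself (no containment relations), i.e. the closed subscheme of `ℙ^{n²+2n}_k` cut out by
the alternation and Plücker relations (Eisenbud–Harris, *3264 and all that*, §3.2.1–§3.2.2).
Mathlib's `Module.Grassmannian` is the functor of points (quotient convention) without scheme
structure. [cite: EisenbudHarris2016, §3.2.1] -/
abbrev grassmannianOfLines : SchemeOver k :=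
  fanoSchemeOfLines n k (∅ : Set (MvPolynomial (Fin (n + 1)) k))

/-- **The Plücker embedding** `G(1, ℙⁿ_k) ↪ ℙ^{n²+2n}_k`, a closed immersion over `k`. [folklore] -/
abbrev plueckerEmbedding : grassmannianOfLines n k ⟶ projectiveSpace 𝐍 k :=
  fanoSchemeOfLinesι n k ∅

/-- The image of the Plücker embedding is the zero locus of the Grassmann equations. [folklore] -/
theorem range_plueckerEmbedding :
    Set.range (plueckerEmbedding n k).left = ProjectiveSpectrum.zeroLocus 𝒫 (grassmannEquations n k) := by
  rw [range_fanoSchemeOfLinesι, fanoEquations_empty]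

variable {n k} in
/-- `F₁(V₊(T)) ↪ F₁(V₊(S))` for `S ⊆ T`, a closed immersion over `k`. [folklore] -/
abbrev fanoSchemeOfLinesInclusion {S T : Set (MvPolynomial (Fin (n + 1)) k)} (h : S ⊆ T) :
    fanoSchemeOfLines n k T ⟶ fanoSchemeOfLines n k S :=
  ProjectiveSpace.subschemeOfFormsInclusion (fanoEquations_mono n k h)

variable {n k} in
/-- The inclusion of Fano schemes commutes with the Plücker embeddings. [folklore] -/
@[simp]
theorem fanoSchemeOfLinesInclusion_ι {S T : Set (MvPolynomial (Fin (n + 1)) k)} (h : S ⊆ T) :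
    fanoSchemeOfLinesInclusion h ≫ fanoSchemeOfLinesι n k S = fanoSchemeOfLinesι n k T :=
  ProjectiveSpace.subschemeOfFormsInclusion_ι _

variable {n k} in
/-- The inclusion of Fano schemes is a closed immersion. [folklore] -/
instance isClosedImmersion_fanoSchemeOfLinesInclusion_left {S T : Set (MvPolynomial (Fin (n + 1)) k)}
    (h : S ⊆ T) : IsClosedImmersion (fanoSchemeOfLinesInclusion h).left :=
  ProjectiveSpace.isClosedImmersion_subschemeOfFormsInclusion_left _

/-- **`F₁(X) ↪ G(1, ℙⁿ)`**: the Fano scheme of lines of `X = V₊(S)` is a closed subscheme of the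
Grassmannian of lines, compatibly with the Plücker embeddings. [folklore] -/
abbrev fanoSchemeToGrassmannian (S : Set (MvPolynomial (Fin (n + 1)) k)) :
    fanoSchemeOfLines n k S ⟶ grassmannianOfLines n k :=
  fanoSchemeOfLinesInclusion (Set.empty_subset S)

/-- `F₁(X) ↪ G(1, ℙⁿ) ↪ ℙ^{n²+2n}` is the Plücker embedding of `F₁(X)`. [folklore] -/
@[simp]
theorem fanoSchemeToGrassmannian_plueckerEmbedding (S : Set (MvPolynomial (Fin (n + 1)) k)) :
    fanoSchemeToGrassmannian n k S ≫ plueckerEmbedding n k = fanoSchemeOfLinesι n k S :=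
  fanoSchemeOfLinesInclusion_ι _

/-- `F₁(X) ↪ G(1, ℙⁿ)` is a closed immersion. [folklore] -/
instance isClosedImmersion_fanoSchemeToGrassmannian_left (S : Set (MvPolynomial (Fin (n + 1)) k)) :
    IsClosedImmersion (fanoSchemeToGrassmannian n k S).left :=
  isClosedImmersion_fanoSchemeOfLinesInclusion_left _

end Scheme

end Literature.AlgebraicGeometry.Motives
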